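import Literature.NumberTheory.Automorphic.Liu2021.Def411WeilCarriersLocalFactorSplitPlace
import Literature.NumberTheory.Automorphic.PrincipalSeriesGL2IsomorphismClass
import Literature.NumberTheory.Automorphic.UnitaryGroupDualPairLocalLineHomeomorph
import HarnessLib

/-!
# [Liu2021, Lem. D.1 (4)] at a SPLIT place, `n = 2`, BOTH directions: two θ-package local factors are isomorphic iff their split data coincide up to the swap

Topic `NumberTheory/Automorphic/Liu2021`; namespace `Literature.NumberTheory.Automorphic.Liu2021.Def411WeilCarriers`.  KERNEL ONLY: theorems;
no definition, no named fact, no `sorry`, no instance, no notation.  Sequel of ★ `Def411WeilCarriersLocalFactorSplitPlace` (the «if»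
direction, ★ `areIsomorphicRep_localFactor_comp_localLineInl_of_split`) and ★ `PrincipalSeriesGL2IsomorphismClass` (★
`Zelevinsky1980.areIsomorphicRep_parabolicIndGL_two_iff`, [BernsteinZelevinsky1977, Thm. 2.9] at `N = 2`).

[Liu2021, App. D, Lemma D.1 (4)] (l. 5235): «If `n = 2` and `ω(μ, ε, χ)` is nonzero, then `ω(μ', ε', χ')` is isomorphic to `ω(μ, ε, χ)`
IF AND ONLY IF either `(μ', ε', χ') = (μ, ε, χ)`, or `μ' = μ^c χ̌`, `χ' = χ`, and …»; proof, first paragraph (p. 126, l. 5241): at a split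
place `ω(μ, ε, χ) ≅ Ind_{Q_{1,1}}^{GL₂}(ν ⊠ χν⁻¹)`, `μ = ν ⊠ ν⁻¹` — «The lemma follows from such description», i.e. from the classification of
the irreducible unitary principal series of `GL₂` up to the Weyl group.  At a SPLIT place the two admissible labels have `w`-components
`ν` and `χν⁻¹`, and the line classes are vacuous; so for the θ-package local factors of two packages `𝓢₁, 𝓢₂` (CM sections at `v`, common
central `w`-reading `χ′`):

* `areIsomorphicRep_of_comp_frames` — bookkeeping converse of ★ `areIsomorphicRep_comp_of_frames`: from `ρ₂ ∘ inl₂ ≅ ρ₁ ∘ inl₁`,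
  `inlᵢ = φᵢ ∘ ψ` with `ψ` ONTO, and `ρᵢ ∘ φᵢ ≅ πᵢ`, conclude `π₂ ≅ π₁`;
* `surjective_reindexGL_kroneckerGL_one_comp_localPiSplitEquiv` — the frame map `k ↦ reindexGL e (e_w^V k ⊗ 1) : U(J_V)(L⁺_v) → GL₂(L_w)`
  is onto (★ `localLineGL_reindexGL_lineEquiv_symm`);
* **`localComponent_eq_or_eq_of_areIsomorphicRep_localFactor_of_split`** («only if»): `Θ_v(2) ∘ localLineInl₂ ≅ Θ_v(1) ∘ localLineInl₁`
  ⇒ `θ₂_w = θ₁_w ∨ θ₂_w = χ′·θ₁_w⁻¹`;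
* **`areIsomorphicRep_localFactor_comp_localLineInl_of_split_iff`** — the two directions together.

Consumer: cell `hodgecm-mathlib`, crux `HLiu418` (P5): with ★ p830308 this is [Liu2021, Lem. D.1 (4)] at `n = 2` AT THE SPLIT PLACES for the
θ-package local factors, entirely in-house; the letter of the pay-down line need only speak of the non-split places.  HC_CM is NOT proved by
anything here.

## References
* [Liu2021] Y. Liu, Camb. J. Math. 9 (2021): App. D Lemma D.1 (4) (l. 5235) and proof of Lemma D.1, first paragraph, p. 126 (l. 5241).
* [BernsteinZelevinsky1977] I. N. Bernstein, A. V. Zelevinsky, Ann. Sci. ÉNS 10 (1977), Thm. 2.9.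
* [GelbartRogawski1991] S. Gelbart, J. Rogawski, Invent. Math. 105 (1991), §3.2 p. 457 (`g ↦ g ⊗ 1`).
-/

set_option autoImplicit false

noncomputable section

open scoped Matrix Kronecker
open NumberField IsDedekindDomain
open Literature.NumberTheory Literature.NumberTheory.Automorphic Literature.NumberTheory.Automorphic.UnitaryGroup
open Literature.NumberTheory.GelbartRogawski1991 Literature.NumberTheory.GelbartRogawski1991.UnitaryDualPair
open Literature.NumberTheory.GelbartRogawski1991.UnitaryDualPair.WeilCoinv
open Literature.NumberTheory.GelbartRogawski1991.UnitaryDualPair.LocalSplitting (localSplittingCM localSchrodinger)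
open Literature.RepresentationTheory.HeisenbergGroup (MpPsi)
open Literature.NumberTheory.GelbartRogawski1991.GRConstruction
open Literature.NumberTheory.Weil1964 Literature.RepresentationTheory
open Literature.NumberTheory.GaloisRepresentations Literature.RepresentationTheory.HarrisKudlaSweet1996
open Literature.NumberTheory.Automorphic.Zelevinsky1980 (lastBlockLabel maxParabolicLeviChar)

namespace Literature.NumberTheory.Automorphic.Liu2021.Def411WeilCarriers

/-! ## §1 Bookkeeping -/

section Generic

/-- **converse assembly along frames**: if `inlᵢ = φᵢ ∘ ψ` pointwise with `ψ` onto, `ρᵢ ∘ φᵢ ≅ πᵢ`, and `ρ₂ ∘ inl₂ ≅ ρ₁ ∘ inl₁`, then `π₂ ≅ π₁`.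
[cite: GelbartRogawski1991, §3.2 p. 457] -/
theorem areIsomorphicRep_of_comp_frames {G G₁ G₂ K : Type*} [Group G] [Group G₁] [Group G₂] [Group K]
    {V₁ V₂ W₁ W₂ : Type*} [AddCommGroup V₁] [Module ℂ V₁] [AddCommGroup V₂] [Module ℂ V₂] [AddCommGroup W₁] [Module ℂ W₁]
    [AddCommGroup W₂] [Module ℂ W₂] {ρ₁ : Representation ℂ G₁ V₁} {ρ₂ : Representation ℂ G₂ V₂}
    {π₁ : Representation ℂ K W₁} {π₂ : Representation ℂ K W₂}
    (inl₁ : G →* G₁) (inl₂ : G →* G₂) (φ₁ : K →* G₁) (φ₂ : K →* G₂) (ψ : G → K) (hψ : Function.Surjective ψ)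
    (hk₁ : ∀ k, inl₁ k = φ₁ (ψ k)) (hk₂ : ∀ k, inl₂ k = φ₂ (ψ k))
    (h₁ : AreIsomorphicRep (ρ₁.comp φ₁) π₁) (h₂ : AreIsomorphicRep (ρ₂.comp φ₂) π₂)
    (h : AreIsomorphicRep (ρ₂.comp inl₂) (ρ₁.comp inl₁)) : AreIsomorphicRep π₂ π₁ := by
  obtain ⟨f₁, hf₁⟩ := h₁
  obtain ⟨f₂, hf₂⟩ := h₂
  obtain ⟨T, hT⟩ := h
  refine ⟨f₂.symm.trans (T.trans f₁), fun g y => ?_⟩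
  obtain ⟨k, rfl⟩ := hψ g
  simp only [LinearEquiv.trans_apply]
  have e₂ := hf₂ (ψ k) (f₂.symm y)
  rw [MonoidHom.comp_apply, LinearEquiv.apply_symm_apply, ← hk₂] at e₂
  -- `e₂ : f₂ (ρ₂ (inl₂ k) (f₂.symm y)) = π₂ (ψ k) y`
  have e₃ := hT k (f₂.symm y)
  rw [MonoidHom.comp_apply, MonoidHom.comp_apply] at e₃
  have e₁ := hf₁ (ψ k) (T (f₂.symm y))
  rw [MonoidHom.comp_apply, ← hk₁] at e₁
  rw [← e₁, ← e₃, ← f₂.symm_apply_eq.2 e₂.symm]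

end Generic

/-! ## §2 The frame map `k ↦ reindexGL e (e_w^V k ⊗ 1)` is onto `GL₂(L_w)` -/

section Frames

/-- `reindex e e ((reindex σ⁻¹ σ⁻¹ M) ⊗ 1) = M` for `σ = (prodUnique)⁻¹ ∘ e : Fin N ≃ Fin n` (matrix bookkeeping of `g ↦ g ⊗ 1` on a line).
[cite: MoeglinVignerasWaldspurger1987, Chap. 1 I.17] -/
private theorem reindexGL_kroneckerGL_one_reindexGL_symm {R : Type*} [CommRing R] {N n : ℕ} (e : Fin N × Fin 1 ≃ Fin n) (g : GL (Fin n) R) :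
    UnitaryGroup.reindexGL e (kroneckerGL (UnitaryGroup.reindexGL ((Equiv.prodUnique (Fin N) (Fin 1)).symm.trans e).symm g, 1)) = g := by
  refine Units.ext (Matrix.ext fun i j => ?_)
  have hi : (Equiv.prodUnique (Fin N) (Fin 1)).symm (e.symm i).1 = e.symm i := Prod.ext rfl (Subsingleton.elim _ _)
  have hj : (Equiv.prodUnique (Fin N) (Fin 1)).symm (e.symm j).1 = e.symm j := Prod.ext rfl (Subsingleton.elim _ _)
  have h2 : (e.symm j).2 = (e.symm i).2 := Subsingleton.elim _ _
  simp only [UnitaryGroup.coe_reindexGL, Matrix.reindex_apply, Matrix.submatrix_apply, coe_kroneckerGL, Matrix.kroneckerMap_apply,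
    Units.val_one, Equiv.symm_symm, Equiv.trans_apply]
  rw [h2, Matrix.one_apply_eq, mul_one, hi, hj, Equiv.apply_symm_apply, Equiv.apply_symm_apply]

/-- **the frame map is onto**: every `g ∈ GL_n(L_w)` is `reindexGL e (e_w^V k ⊗ 1)` for some `k ∈ U(J_V)(L⁺_v)` — `k := e_w^{V,-1}(reindex σ⁻¹ g)`.
[cite: GelbartRogawski1991, §3.2 p. 457] [cite: MoeglinVignerasWaldspurger1987, Chap. 1 I.17] -/
theorem surjective_reindexGL_kroneckerGL_one_comp_localPiSplitEquiv
    {F E : Type} [Field F] [NumberField F] [Field E] [NumberField E] [Algebra F E] [Algebra.IsQuadraticExtension F E]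
    (c : E ≃ₐ[F] E) (N : ℕ) {n : ℕ} (e : Fin N × Fin 1 ≃ Fin n) (JV : Matrix (Fin N) (Fin N) E) (hc : c ≠ 1) (hJVh : (JV.map c)ᵀ = JV)
    {v : HeightOneSpectrum (𝓞 F)} (w : UnitaryGroup.PlacesOver E v) (hw : c • (w : HeightOneSpectrum (𝓞 E)) ≠ w)
    (hJVw : IsUnit (UnitaryGroup.placeForm JV (w : HeightOneSpectrum (𝓞 E)))) :
    Function.Surjective fun k : UnitaryGroup.localPi E c N JV v =>
      UnitaryGroup.reindexGL e (kroneckerGL (UnitaryGroup.localPiSplitEquiv c JV hc hJVh w hw hJVw k, 1)) := by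
  intro g
  refine ⟨(UnitaryGroup.localPiSplitEquiv c JV hc hJVh w hw hJVw).symm
    (UnitaryGroup.reindexGL ((Equiv.prodUnique (Fin N) (Fin 1)).symm.trans e).symm g), ?_⟩
  simp only [ContinuousMulEquiv.apply_symm_apply]
  exact reindexGL_kroneckerGL_one_reindexGL_symm e g

end Frames

/-! ## §3 [Liu2021, Lem. D.1 (4)] at a split place, `n = 2`: «only if», and the equivalence -/

section Split

/-- `ψ^{1-2} = ψ⁻¹`. [folklore] -/
private theorem zpow_one_sub_two_eq_inv' {M : Type*} [Monoid M] (ψ : M →* ℂˣ) : ψ ^ (1 - ((2 : ℕ) : ℤ)) = ψ⁻¹ := by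
  rw [show (1 - ((2 : ℕ) : ℤ)) = -1 by norm_num]
  exact zpow_neg_one ψ

/-- `χ′ · ν^{1-2}` is unitary for unitary `ν, χ′`. [folklore] -/
private theorem norm_mul_zpow_apply_eq_one {M : Type*} [Monoid M] (ν χ' : M →* ℂˣ) (hνu : ∀ x, ‖((ν x : ℂˣ) : ℂ)‖ = 1)
    (hχ'u : ∀ x, ‖((χ' x : ℂˣ) : ℂ)‖ = 1) (x : M) : ‖(((χ' * ν ^ (1 - ((2 : ℕ) : ℤ))) x : ℂˣ) : ℂ)‖ = 1 := by
  rw [zpow_one_sub_two_eq_inv', MonoidHom.mul_apply, MonoidHom.inv_apply, Units.val_mul, Units.val_inv_eq_inv_val, norm_mul,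
    norm_inv, hνu, hχ'u, inv_one, mul_one]

/-- `χ′ · ν^{1-2}` is continuous for continuous `ν, χ′`. [folklore] -/
private theorem continuous_mul_zpow_apply {M : Type*} [Monoid M] [TopologicalSpace M] (ν χ' : M →* ℂˣ)
    (hνc : Continuous fun x => ((ν x : ℂˣ) : ℂ)) (hχ'c : Continuous fun x => ((χ' x : ℂˣ) : ℂ)) :
    Continuous fun x => (((χ' * ν ^ (1 - ((2 : ℕ) : ℤ))) x : ℂˣ) : ℂ) := by
  have h : (fun x => (((χ' * ν ^ (1 - ((2 : ℕ) : ℤ))) x : ℂˣ) : ℂ)) = fun x => ((χ' x : ℂˣ) : ℂ) * (((ν x : ℂˣ) : ℂ))⁻¹ := by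
    funext x
    rw [zpow_one_sub_two_eq_inv', MonoidHom.mul_apply, MonoidHom.inv_apply, Units.val_mul, Units.val_inv_eq_inv_val]
  rw [h]
  exact hχ'c.mul (hνc.inv₀ fun x => (ν x).ne_zero)

set_option maxHeartbeats 3000000 in -- two ★ `areIsomorphicRep_localFactor_comp_splitFrame_symm` instances (the explicit split model elaborates at 2 M)
/-- **[Liu2021, Lem. D.1 (4)] AT A SPLIT PLACE, `n = 2`, «ONLY IF», FOR THE θ-PACKAGE LOCAL FACTORS.**  Same data as ★
`areIsomorphicRep_localFactor_comp_localLineInl_of_split` WITHOUT the label clause: if `Θ_v(2) ∘ localLineInl₂ ≅ Θ_v(1) ∘ localLineInl₁`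
as representations of `U(J_V)(L⁺_v)`, then `θ₂_w = θ₁_w` or `θ₂_w = χ′ · θ₁_w⁻¹` — the two principal series `i(θᵢ_w ⊠ χ′θᵢ_w^{1-2})` of
`GL₂(L_w)` are isomorphic (frames ONTO), hence have the same inducing datum up to the swap (★
`Zelevinsky1980.areIsomorphicRep_parabolicIndGL_two_iff`). [cite: Liu2021, App. D Lemma D.1 (4) (l. 5235) and proof of Lemma D.1 (first paragraph), p. 126]
[cite: BernsteinZelevinsky1977, Thm. 2.9] -/
theorem localComponent_eq_or_eq_of_areIsomorphicRep_localFactor_of_split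
    (L : Type) [Field L] [NumberField L] [IsCMField L] (hc1 : IsCMField.complexConj L ≠ 1)
    {n' : ℕ} (e : Fin 2 × Fin 1 ≃ Fin n')
    (dV : Fin 2 → L) (hdV : ∀ i, IsCMField.complexConj L (dV i) = dV i) (hdV0 : ∀ i, dV i ≠ 0)
    (a₁ a₂ : (Fp L)ˣ) (χ₁ χ₂ : Chi (Fp L) L (IsCMField.complexConj L))
    (𝓢₁ : LocalSplitting.FinLocalSplittings (Fp L) L (IsCMField.complexConj L) n' (complexConj_imagUnit L) (imagUnit_ne_zero L) (imagUnit_mul_self L) (gram (Fp L) e (realDiagonal L dV hdV) (TW (Fp L) a₁))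
      (isSymm_gram (Fp L) e (realDiagonal_isSymm L dV hdV) (isSymm_TW (Fp L) a₁))
      (reindex_kronecker_eq_gram_map (Fp L) L e (realDiagonal_map L dV hdV).symm (JW_eq (Fp L) L a₁)))
    (𝓢₂ : LocalSplitting.FinLocalSplittings (Fp L) L (IsCMField.complexConj L) n' (complexConj_imagUnit L) (imagUnit_ne_zero L) (imagUnit_mul_self L) (gram (Fp L) e (realDiagonal L dV hdV) (TW (Fp L) a₂))
      (isSymm_gram (Fp L) e (realDiagonal_isSymm L dV hdV) (isSymm_TW (Fp L) a₂))
      (reindex_kronecker_eq_gram_map (Fp L) L e (realDiagonal_map L dV hdV).symm (JW_eq (Fp L) L a₂)))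
    (θ₁ θ₂ : HeckeCharacter L) (hθ₁ : IsSplittingChar L 1 θ₁) (hθ₂ : IsSplittingChar L 1 θ₂)
    (hθ₁u : θ₁.IsUnitary) (hθ₂u : θ₂.IsUnitary)
    (v : HeightOneSpectrum (𝓞 (Fp L))) (w : UnitaryGroup.PlacesOver L v)
    (hw : IsCMField.complexConj L • (w : HeightOneSpectrum (𝓞 L)) ≠ w)
    (hs₁ : (𝓢₁).s v = localSplittingCM L n' (T₀ := gram (Fp L) e (realDiagonal L dV hdV) (TW (Fp L) a₁))
        (isSymm_gram (Fp L) e (realDiagonal_isSymm L dV hdV) (isSymm_TW (Fp L) a₁))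
        (isUnit_det_gram (Fp L) e (isUnit_det_realDiagonal L dV hdV hdV0) (isUnit_det_TW (Fp L) a₁))
        (reindex_kronecker_eq_gram_map (Fp L) L e (realDiagonal_map L dV hdV).symm (JW_eq (Fp L) L a₁)) θ₁ hθ₁ v)
    (hs₂ : (𝓢₂).s v = localSplittingCM L n' (T₀ := gram (Fp L) e (realDiagonal L dV hdV) (TW (Fp L) a₂))
        (isSymm_gram (Fp L) e (realDiagonal_isSymm L dV hdV) (isSymm_TW (Fp L) a₂))
        (isUnit_det_gram (Fp L) e (isUnit_det_realDiagonal L dV hdV hdV0) (isUnit_det_TW (Fp L) a₂))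
        (reindex_kronecker_eq_gram_map (Fp L) L e (realDiagonal_map L dV hdV).symm (JW_eq (Fp L) L a₂)) θ₂ hθ₂ v)
    [LocallyCompactSpace (standardParabolicGL ((w : HeightOneSpectrum (𝓞 L)).adicCompletion L) (lastBlockLabel n'))]
    (χ' : (((w : HeightOneSpectrum (𝓞 L)).adicCompletion L))ˣ →* ℂˣ)
    (hχ'₁ : ∀ z : UnitaryGroup.localPi L (IsCMField.complexConj L) 1 (JW (Fp L) L a₁) v,
        χ' (Matrix.GeneralLinearGroup.det ((z : UnitaryGroup.LocalGLPi L 1 v) w)) =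
          localCharOfCenter (Fp L) L (IsCMField.complexConj L) (JW (Fp L) L a₁) (JW_apply_ne_zero (Fp L) L a₁) (χ₁).1 v z)
    (hχ'₂ : ∀ z : UnitaryGroup.localPi L (IsCMField.complexConj L) 1 (JW (Fp L) L a₂) v,
        χ' (Matrix.GeneralLinearGroup.det ((z : UnitaryGroup.LocalGLPi L 1 v) w)) =
          localCharOfCenter (Fp L) L (IsCMField.complexConj L) (JW (Fp L) L a₂) (JW_apply_ne_zero (Fp L) L a₂) (χ₂).1 v z)
    (h : AreIsomorphicRep
      (show Representation ℂ (UnitaryGroup.localPi L (IsCMField.complexConj L) 2 (Matrix.diagonal dV) v) _ from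
        (TwistedCoinv.rep (localCharOfCenter (Fp L) L (IsCMField.complexConj L) (JW (Fp L) L a₂) (JW_apply_ne_zero (Fp L) L a₂) (χ₂).1 v) ((𝓢₂).omegaLoc v)
          (commute_omegaLoc_localCenter (Fp L) L (IsCMField.complexConj L) 2 e (Matrix.diagonal dV) (JW (Fp L) L a₂) (complexConj_imagUnit L) (imagUnit_ne_zero L) (imagUnit_mul_self L) (realDiagonal_isSymm L dV hdV) (isSymm_TW (Fp L) a₂) (realDiagonal_map L dV hdV).symm
            (JW_eq (Fp L) L a₂) (JW_apply_ne_zero (Fp L) L a₂) 𝓢₂ v)).comp (UnitaryGroup.localLineInl L (IsCMField.complexConj L) 2 e (Matrix.diagonal dV) (JW (Fp L) L a₂) v))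
      (show Representation ℂ (UnitaryGroup.localPi L (IsCMField.complexConj L) 2 (Matrix.diagonal dV) v) _ from
        (TwistedCoinv.rep (localCharOfCenter (Fp L) L (IsCMField.complexConj L) (JW (Fp L) L a₁) (JW_apply_ne_zero (Fp L) L a₁) (χ₁).1 v) ((𝓢₁).omegaLoc v)
          (commute_omegaLoc_localCenter (Fp L) L (IsCMField.complexConj L) 2 e (Matrix.diagonal dV) (JW (Fp L) L a₁) (complexConj_imagUnit L) (imagUnit_ne_zero L) (imagUnit_mul_self L) (realDiagonal_isSymm L dV hdV) (isSymm_TW (Fp L) a₁) (realDiagonal_map L dV hdV).symm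
            (JW_eq (Fp L) L a₁) (JW_apply_ne_zero (Fp L) L a₁) 𝓢₁ v)).comp (UnitaryGroup.localLineInl L (IsCMField.complexConj L) 2 e (Matrix.diagonal dV) (JW (Fp L) L a₁) v))) :
    θ₂.localComponent (w : HeightOneSpectrum (𝓞 L)) = θ₁.localComponent (w : HeightOneSpectrum (𝓞 L)) ∨ θ₂.localComponent (w : HeightOneSpectrum (𝓞 L)) = χ' * (θ₁.localComponent (w : HeightOneSpectrum (𝓞 L)))⁻¹ := by
  classical
  obtain rfl : n' = 2 := by
    have h := Fintype.card_congr e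
    simp only [Fintype.card_prod, Fintype.card_fin] at h
    omega
  have hJh₁ : (((Matrix.reindex e e ((Matrix.diagonal dV) ⊗ₖ JW (Fp L) L a₁))).map (IsCMField.complexConj L))ᵀ = (Matrix.reindex e e ((Matrix.diagonal dV) ⊗ₖ JW (Fp L) L a₁)) := transpose_map_conj_JV (Fp L) L (IsCMField.complexConj L) 2 _ (isSymm_gram (Fp L) e (realDiagonal_isSymm L dV hdV) (isSymm_TW (Fp L) a₁)) (reindex_kronecker_eq_gram_map (Fp L) L e (realDiagonal_map L dV hdV).symm (JW_eq (Fp L) L a₁))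
  have hJh₂ : (((Matrix.reindex e e ((Matrix.diagonal dV) ⊗ₖ JW (Fp L) L a₂))).map (IsCMField.complexConj L))ᵀ = (Matrix.reindex e e ((Matrix.diagonal dV) ⊗ₖ JW (Fp L) L a₂)) := transpose_map_conj_JV (Fp L) L (IsCMField.complexConj L) 2 _ (isSymm_gram (Fp L) e (realDiagonal_isSymm L dV hdV) (isSymm_TW (Fp L) a₂)) (reindex_kronecker_eq_gram_map (Fp L) L e (realDiagonal_map L dV hdV).symm (JW_eq (Fp L) L a₂))
  have hJVh : (((Matrix.diagonal dV)).map (IsCMField.complexConj L))ᵀ = (Matrix.diagonal dV) := transpose_map_conj_JV (Fp L) L (IsCMField.complexConj L) 2 _ (realDiagonal_isSymm L dV hdV) (realDiagonal_map L dV hdV).symm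
  have hJw₁ : IsUnit (UnitaryGroup.placeForm (Matrix.reindex e e ((Matrix.diagonal dV) ⊗ₖ JW (Fp L) L a₁)) (w : HeightOneSpectrum (𝓞 L))) :=
    UnitaryGroup.isUnit_placeForm _ ((Matrix.isUnit_iff_isUnit_det _).2
      (isUnit_iff_ne_zero.2 (det_JV_ne_zero (Fp L) L 2 _ (isUnit_det_gram (Fp L) e (isUnit_det_realDiagonal L dV hdV hdV0) (isUnit_det_TW (Fp L) a₁)) (reindex_kronecker_eq_gram_map (Fp L) L e (realDiagonal_map L dV hdV).symm (JW_eq (Fp L) L a₁))))) _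
  have hJw₂ : IsUnit (UnitaryGroup.placeForm (Matrix.reindex e e ((Matrix.diagonal dV) ⊗ₖ JW (Fp L) L a₂)) (w : HeightOneSpectrum (𝓞 L))) :=
    UnitaryGroup.isUnit_placeForm _ ((Matrix.isUnit_iff_isUnit_det _).2
      (isUnit_iff_ne_zero.2 (det_JV_ne_zero (Fp L) L 2 _ (isUnit_det_gram (Fp L) e (isUnit_det_realDiagonal L dV hdV hdV0) (isUnit_det_TW (Fp L) a₂)) (reindex_kronecker_eq_gram_map (Fp L) L e (realDiagonal_map L dV hdV).symm (JW_eq (Fp L) L a₂))))) _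
  have hJVw : IsUnit (UnitaryGroup.placeForm (Matrix.diagonal dV) (w : HeightOneSpectrum (𝓞 L))) :=
    UnitaryGroup.isUnit_placeForm _ ((Matrix.isUnit_iff_isUnit_det _).2
      (isUnit_iff_ne_zero.2 (det_JV_ne_zero (Fp L) L 2 _ (isUnit_det_realDiagonal L dV hdV hdV0) (realDiagonal_map L dV hdV).symm))) _
  obtain ⟨⟨hθ₁wu, hθ₁wc, hχ'u, hχ'c⟩, N₁⟩ := areIsomorphicRep_localFactor_comp_splitFrame_symm L hc1 e dV hdV hdV0 a₁ χ₁ 𝓢₁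
    θ₁ hθ₁ hθ₁u v w hw hs₁ hJh₁ hJw₁ χ' hχ'₁
  obtain ⟨⟨hθ₂wu, hθ₂wc, -, -⟩, N₂⟩ := areIsomorphicRep_localFactor_comp_splitFrame_symm L hc1 e dV hdV hdV0 a₂ χ₂ 𝓢₂
    θ₂ hθ₂ hθ₂u v w hw hs₂ hJh₂ hJw₂ χ' hχ'₂
  have hk₁ : ∀ k, UnitaryGroup.localLineInl L (IsCMField.complexConj L) 2 e (Matrix.diagonal dV) (JW (Fp L) L a₁) v k =
      (UnitaryGroup.localPiSplitEquiv (IsCMField.complexConj L) (Matrix.reindex e e ((Matrix.diagonal dV) ⊗ₖ JW (Fp L) L a₁)) hc1 hJh₁ w hw hJw₁).symm.toMonoidHom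
        (UnitaryGroup.reindexGL e (kroneckerGL (UnitaryGroup.localPiSplitEquiv (IsCMField.complexConj L) (Matrix.diagonal dV) hc1 hJVh w hw hJVw k, 1))) := by
    intro k
    have h := UnitaryGroup.localLineInl_localPiSplitEquiv_symm_apply L (IsCMField.complexConj L) 2 e (Matrix.diagonal dV) (JW (Fp L) L a₁) hc1 hJVh hJh₁ w hw hJVw hJw₁
      (UnitaryGroup.localPiSplitEquiv (IsCMField.complexConj L) (Matrix.diagonal dV) hc1 hJVh w hw hJVw k)
    rwa [ContinuousMulEquiv.symm_apply_apply] at h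
  have hk₂ : ∀ k, UnitaryGroup.localLineInl L (IsCMField.complexConj L) 2 e (Matrix.diagonal dV) (JW (Fp L) L a₂) v k =
      (UnitaryGroup.localPiSplitEquiv (IsCMField.complexConj L) (Matrix.reindex e e ((Matrix.diagonal dV) ⊗ₖ JW (Fp L) L a₂)) hc1 hJh₂ w hw hJw₂).symm.toMonoidHom
        (UnitaryGroup.reindexGL e (kroneckerGL (UnitaryGroup.localPiSplitEquiv (IsCMField.complexConj L) (Matrix.diagonal dV) hc1 hJVh w hw hJVw k, 1))) := by
    intro k
    have h := UnitaryGroup.localLineInl_localPiSplitEquiv_symm_apply L (IsCMField.complexConj L) 2 e (Matrix.diagonal dV) (JW (Fp L) L a₂) hc1 hJVh hJh₂ w hw hJVw hJw₂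
      (UnitaryGroup.localPiSplitEquiv (IsCMField.complexConj L) (Matrix.diagonal dV) hc1 hJVh w hw hJVw k)
    rwa [ContinuousMulEquiv.symm_apply_apply] at h
  -- the two principal series are isomorphic
  have hPS : AreIsomorphicRep
      (Representation.parabolicIndGL ((w : HeightOneSpectrum (𝓞 L)).adicCompletion L) (lastBlockLabel 2) ((Representation.trivial ℂ (Π b : Bool, GL {i : Fin 2 // lastBlockLabel 2 i = b} ((w : HeightOneSpectrum (𝓞 L)).adicCompletion L)) ℂ).twist (maxParabolicLeviChar ((w : HeightOneSpectrum (𝓞 L)).adicCompletion L) 2 (θ₂.localComponent (w : HeightOneSpectrum (𝓞 L))) (χ' * (θ₂.localComponent (w : HeightOneSpectrum (𝓞 L))) ^ (1 - ((2 : ℕ) : ℤ))))))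
      (Representation.parabolicIndGL ((w : HeightOneSpectrum (𝓞 L)).adicCompletion L) (lastBlockLabel 2) ((Representation.trivial ℂ (Π b : Bool, GL {i : Fin 2 // lastBlockLabel 2 i = b} ((w : HeightOneSpectrum (𝓞 L)).adicCompletion L)) ℂ).twist (maxParabolicLeviChar ((w : HeightOneSpectrum (𝓞 L)).adicCompletion L) 2 (θ₁.localComponent (w : HeightOneSpectrum (𝓞 L))) (χ' * (θ₁.localComponent (w : HeightOneSpectrum (𝓞 L))) ^ (1 - ((2 : ℕ) : ℤ)))))) :=
    areIsomorphicRep_of_comp_frames _ _ _ _ _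
      (surjective_reindexGL_kroneckerGL_one_comp_localPiSplitEquiv (IsCMField.complexConj L) 2 e (Matrix.diagonal dV) hc1 hJVh w hw hJVw) hk₁ hk₂ N₁ N₂ h
  -- classification of the unitary principal series of `GL₂`
  have hcl := (Zelevinsky1980.areIsomorphicRep_parabolicIndGL_two_iff ((w : HeightOneSpectrum (𝓞 L)).adicCompletion L)
    (θ₂.localComponent (w : HeightOneSpectrum (𝓞 L))) (χ' * (θ₂.localComponent (w : HeightOneSpectrum (𝓞 L))) ^ (1 - ((2 : ℕ) : ℤ))) (θ₁.localComponent (w : HeightOneSpectrum (𝓞 L))) (χ' * (θ₁.localComponent (w : HeightOneSpectrum (𝓞 L))) ^ (1 - ((2 : ℕ) : ℤ)))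
    hθ₂wu hθ₂wc (norm_mul_zpow_apply_eq_one _ _ hθ₂wu hχ'u) (continuous_mul_zpow_apply _ _ hθ₂wc hχ'c)
    hθ₁wc (continuous_mul_zpow_apply _ _ hθ₁wc hχ'c)).1 hPS
  rcases hcl with ⟨h1, -⟩ | ⟨h1, -⟩
  · exact Or.inl h1
  · right
    rw [h1, zpow_one_sub_two_eq_inv']

set_option maxHeartbeats 3000000 in -- as above
/-- **[Liu2021, Lem. D.1 (4)] AT A SPLIT PLACE, `n = 2`, FOR THE θ-PACKAGE LOCAL FACTORS — THE EQUIVALENCE**: for two packages `𝓢₁, 𝓢₂`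
(CM sections at `v`, lines `⟨a₁⟩, ⟨a₂⟩`, unitary splitting characters `θ₁, θ₂`, central characters with a common `w`-reading `χ′`) at a
place `v` of `L⁺` split in `L`: `Θ_v(2) ∘ localLineInl₂ ≅ Θ_v(1) ∘ localLineInl₁ ↔ (θ₂_w = θ₁_w ∨ θ₂_w = χ′·θ₁_w⁻¹)` — ★
`areIsomorphicRep_localFactor_comp_localLineInl_of_split` (⇐) and `localComponent_eq_or_eq_of_areIsomorphicRep_localFactor_of_split` (⇒).
[cite: Liu2021, App. D Lemma D.1 (4) (l. 5235) and proof of Lemma D.1 (first paragraph), p. 126] [cite: BernsteinZelevinsky1977, Thm. 2.9] -/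
theorem areIsomorphicRep_localFactor_comp_localLineInl_of_split_iff
    (L : Type) [Field L] [NumberField L] [IsCMField L] (hc1 : IsCMField.complexConj L ≠ 1)
    {n' : ℕ} (e : Fin 2 × Fin 1 ≃ Fin n')
    (dV : Fin 2 → L) (hdV : ∀ i, IsCMField.complexConj L (dV i) = dV i) (hdV0 : ∀ i, dV i ≠ 0)
    (a₁ a₂ : (Fp L)ˣ) (χ₁ χ₂ : Chi (Fp L) L (IsCMField.complexConj L))
    (𝓢₁ : LocalSplitting.FinLocalSplittings (Fp L) L (IsCMField.complexConj L) n' (complexConj_imagUnit L) (imagUnit_ne_zero L) (imagUnit_mul_self L) (gram (Fp L) e (realDiagonal L dV hdV) (TW (Fp L) a₁))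
      (isSymm_gram (Fp L) e (realDiagonal_isSymm L dV hdV) (isSymm_TW (Fp L) a₁))
      (reindex_kronecker_eq_gram_map (Fp L) L e (realDiagonal_map L dV hdV).symm (JW_eq (Fp L) L a₁)))
    (𝓢₂ : LocalSplitting.FinLocalSplittings (Fp L) L (IsCMField.complexConj L) n' (complexConj_imagUnit L) (imagUnit_ne_zero L) (imagUnit_mul_self L) (gram (Fp L) e (realDiagonal L dV hdV) (TW (Fp L) a₂))
      (isSymm_gram (Fp L) e (realDiagonal_isSymm L dV hdV) (isSymm_TW (Fp L) a₂))
      (reindex_kronecker_eq_gram_map (Fp L) L e (realDiagonal_map L dV hdV).symm (JW_eq (Fp L) L a₂)))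
    (θ₁ θ₂ : HeckeCharacter L) (hθ₁ : IsSplittingChar L 1 θ₁) (hθ₂ : IsSplittingChar L 1 θ₂)
    (hθ₁u : θ₁.IsUnitary) (hθ₂u : θ₂.IsUnitary)
    (v : HeightOneSpectrum (𝓞 (Fp L))) (w : UnitaryGroup.PlacesOver L v)
    (hw : IsCMField.complexConj L • (w : HeightOneSpectrum (𝓞 L)) ≠ w)
    (hs₁ : (𝓢₁).s v = localSplittingCM L n' (T₀ := gram (Fp L) e (realDiagonal L dV hdV) (TW (Fp L) a₁))
        (isSymm_gram (Fp L) e (realDiagonal_isSymm L dV hdV) (isSymm_TW (Fp L) a₁))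
        (isUnit_det_gram (Fp L) e (isUnit_det_realDiagonal L dV hdV hdV0) (isUnit_det_TW (Fp L) a₁))
        (reindex_kronecker_eq_gram_map (Fp L) L e (realDiagonal_map L dV hdV).symm (JW_eq (Fp L) L a₁)) θ₁ hθ₁ v)
    (hs₂ : (𝓢₂).s v = localSplittingCM L n' (T₀ := gram (Fp L) e (realDiagonal L dV hdV) (TW (Fp L) a₂))
        (isSymm_gram (Fp L) e (realDiagonal_isSymm L dV hdV) (isSymm_TW (Fp L) a₂))
        (isUnit_det_gram (Fp L) e (isUnit_det_realDiagonal L dV hdV hdV0) (isUnit_det_TW (Fp L) a₂))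
        (reindex_kronecker_eq_gram_map (Fp L) L e (realDiagonal_map L dV hdV).symm (JW_eq (Fp L) L a₂)) θ₂ hθ₂ v)
    [LocallyCompactSpace (standardParabolicGL ((w : HeightOneSpectrum (𝓞 L)).adicCompletion L) (lastBlockLabel n'))]
    (χ' : (((w : HeightOneSpectrum (𝓞 L)).adicCompletion L))ˣ →* ℂˣ)
    (hχ'₁ : ∀ z : UnitaryGroup.localPi L (IsCMField.complexConj L) 1 (JW (Fp L) L a₁) v,
        χ' (Matrix.GeneralLinearGroup.det ((z : UnitaryGroup.LocalGLPi L 1 v) w)) =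
          localCharOfCenter (Fp L) L (IsCMField.complexConj L) (JW (Fp L) L a₁) (JW_apply_ne_zero (Fp L) L a₁) (χ₁).1 v z)
    (hχ'₂ : ∀ z : UnitaryGroup.localPi L (IsCMField.complexConj L) 1 (JW (Fp L) L a₂) v,
        χ' (Matrix.GeneralLinearGroup.det ((z : UnitaryGroup.LocalGLPi L 1 v) w)) =
          localCharOfCenter (Fp L) L (IsCMField.complexConj L) (JW (Fp L) L a₂) (JW_apply_ne_zero (Fp L) L a₂) (χ₂).1 v z) :
    AreIsomorphicRep
      (show Representation ℂ (UnitaryGroup.localPi L (IsCMField.complexConj L) 2 (Matrix.diagonal dV) v) _ from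
        (TwistedCoinv.rep (localCharOfCenter (Fp L) L (IsCMField.complexConj L) (JW (Fp L) L a₂) (JW_apply_ne_zero (Fp L) L a₂) (χ₂).1 v) ((𝓢₂).omegaLoc v)
          (commute_omegaLoc_localCenter (Fp L) L (IsCMField.complexConj L) 2 e (Matrix.diagonal dV) (JW (Fp L) L a₂) (complexConj_imagUnit L) (imagUnit_ne_zero L) (imagUnit_mul_self L) (realDiagonal_isSymm L dV hdV) (isSymm_TW (Fp L) a₂) (realDiagonal_map L dV hdV).symm
            (JW_eq (Fp L) L a₂) (JW_apply_ne_zero (Fp L) L a₂) 𝓢₂ v)).comp (UnitaryGroup.localLineInl L (IsCMField.complexConj L) 2 e (Matrix.diagonal dV) (JW (Fp L) L a₂) v))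
      (show Representation ℂ (UnitaryGroup.localPi L (IsCMField.complexConj L) 2 (Matrix.diagonal dV) v) _ from
        (TwistedCoinv.rep (localCharOfCenter (Fp L) L (IsCMField.complexConj L) (JW (Fp L) L a₁) (JW_apply_ne_zero (Fp L) L a₁) (χ₁).1 v) ((𝓢₁).omegaLoc v)
          (commute_omegaLoc_localCenter (Fp L) L (IsCMField.complexConj L) 2 e (Matrix.diagonal dV) (JW (Fp L) L a₁) (complexConj_imagUnit L) (imagUnit_ne_zero L) (imagUnit_mul_self L) (realDiagonal_isSymm L dV hdV) (isSymm_TW (Fp L) a₁) (realDiagonal_map L dV hdV).symm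
            (JW_eq (Fp L) L a₁) (JW_apply_ne_zero (Fp L) L a₁) 𝓢₁ v)).comp (UnitaryGroup.localLineInl L (IsCMField.complexConj L) 2 e (Matrix.diagonal dV) (JW (Fp L) L a₁) v)) ↔
    (θ₂.localComponent (w : HeightOneSpectrum (𝓞 L)) = θ₁.localComponent (w : HeightOneSpectrum (𝓞 L)) ∨ θ₂.localComponent (w : HeightOneSpectrum (𝓞 L)) = χ' * (θ₁.localComponent (w : HeightOneSpectrum (𝓞 L)))⁻¹) :=
  ⟨localComponent_eq_or_eq_of_areIsomorphicRep_localFactor_of_split L hc1 e dV hdV hdV0 a₁ a₂ χ₁ χ₂ 𝓢₁ 𝓢₂ θ₁ θ₂ hθ₁ hθ₂ hθ₁u hθ₂u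
      v w hw hs₁ hs₂ χ' hχ'₁ hχ'₂,
    areIsomorphicRep_localFactor_comp_localLineInl_of_split L hc1 e dV hdV hdV0 a₁ a₂ χ₁ χ₂ 𝓢₁ 𝓢₂ θ₁ θ₂ hθ₁ hθ₂ hθ₁u hθ₂u
      v w hw hs₁ hs₂ χ' hχ'₁ hχ'₂⟩

end Split

end Literature.NumberTheory.Automorphic.Liu2021.Def411WeilCarriers

end
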